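import Literature.NumberTheory.Automorphic.AdmissibleTorusFactorisation
import Literature.NumberTheory.Automorphic.BorelModelOrbitRepresentatives
import Literature.NumberTheory.Automorphic.HeckeOrbitConjugation
import Literature.NumberTheory.Automorphic.TorusEigencharacter
import HarnessLib

/-!
# The `t^B_2`-eigenvalues on the Borel stratum of a Bianchi group form an algebraic character

Topic `NumberTheory/Automorphic`; namespace `Literature.NumberTheory.Automorphic.ParallelWeight`.
Theorems and two auxiliary definitions with bodies.

Let `F` be imaginary quadratic, `𝔫 ≠ 0` a neat level, `S ⊇ {v ∣ 𝔫}`, and `y₀ ≠ 0` a class in the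
Borel model `H^q(B(F), Fun(H_S ⧸ (K_f(𝔫) ∩ H_S), V_wt(E)))` with `T^B_{e₂,w} y₀ = μ_w y₀` for all
`w ∉ S` (`BorelEigenvalueFactorisation`).  Then there are integers `e_τ` (`τ : F →+* E`) with

  `∏_{w ∣ (x)} μ_w^{ord_w x} = ∏_τ τ(x)^{e_τ}`

for every *admissible* `x ∈ 𝓞_F` (`x ≠ 0`, `x ≡ 1 mod 𝔫`, `x` prime to `S`)
(`exists_torus_exponents`).  Proof [Harder1987, §2, (2.3)–(2.7)]: the Hecke operator of the torus
element `ι(diag(1,x))` is `∏_w (T^B_{e₂,w})^{ord_w x}` (`AdmissibleTorusFactorisation`), so it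
multiplies `y₀` by the left-hand side; restricted to the orbit of a supported boundary point
`diag(t) c` on which `y₀` is non-zero (`BorelModelOrbitRepresentatives`) it becomes the pair map of
the conjugation by `t_x = diag(1, x) ∈ B(F)` on `H^q(Λ, V_wt)`, `Λ` the stabiliser lattice
(`HeckeOrbitConjugation`, the orbit condition of `AdmissibleTorusOrbit`), whose common eigenvalues
are the algebraic characters `χ_I(t_x) ∏_τ τ(x)^{p_τ}` (`TorusEigencharacter`).

## References

* G. Harder, *Eisenstein cohomology of arithmetic groups. The case GL₂*, Invent. Math. 89 (1987),
  §2, (2.3)–(2.7). [Harder1987]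
-/

noncomputable section

open scoped NumberField
open IsDedekindDomain CategoryTheory Literature.Algebra.Homology

namespace Literature.NumberTheory.Automorphic.ParallelWeight

open BigHeckeGLn GLnCohomology

variable {F : Type} [Field F] [NumberField F]

/-! ### Eigenvalues of products of operators -/

/-- `Tⁿ y = μⁿ y` for an eigenvector. [folklore] -/
theorem pow_apply_eq_pow_smul {R M : Type*} [CommSemiring R] [AddCommMonoid M] [Module R M]
    (T : Module.End R M) (μ : R) (y : M) (h : T y = μ • y) (n : ℕ) : (T ^ n) y = μ ^ n • y := by
  induction n with
  | zero => rw [pow_zero, pow_zero, one_smul, Module.End.one_apply]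
  | succ n ih => rw [pow_succ, Module.End.mul_apply, h, map_smul, ih, smul_smul, pow_succ, mul_comm]

/-- `(∏ T_a) y = (∏ μ_a) y` for a common eigenvector. [folklore] -/
theorem list_prod_apply_eq_prod_smul {R M α : Type*} [CommSemiring R] [AddCommMonoid M] [Module R M]
    (T : α → Module.End R M) (μ : α → R) (y : M) (l : List α) (h : ∀ a ∈ l, T a y = μ a • y) :
    (l.map T).prod y = (l.map μ).prod • y := by
  induction l with
  | nil => rw [List.map_nil, List.map_nil, List.prod_nil, List.prod_nil, one_smul, Module.End.one_apply]
  | cons a l ih =>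
    rw [List.map_cons, List.map_cons, List.prod_cons, List.prod_cons, Module.End.mul_apply,
      ih (fun b hb => h b (List.mem_cons_of_mem _ hb)), map_smul, h a List.mem_cons_self, smul_smul, mul_comm]

/-! ### The torus elements `t_x = diag(1, x) ∈ B(F)` -/

/-- `t_x = diag(1, x) ∈ B(F)`. [folklore] -/
def diagOneXB (x : F) (hx : x ≠ 0) : borel F :=
  ⟨diagOneX x hx, by
    rw [mem_borel_iff, coe_diagOneX]
    exact Matrix.diagonal_apply_ne _ (by decide)⟩

/-- `ι_S(t_x) = ι(diag(1, x)) ∈ H_S`. [folklore] -/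
theorem borelToAwayFrom_diagOneXB (S : Set (HeightOneSpectrum (𝓞 F))) (x : F) (hx : x ≠ 0) :
    borelToAwayFrom F S (diagOneXB x hx) = admissibleDiagH S x hx := rfl

omit [NumberField F] in
/-- The `(0,1)` entry of `t_x` vanishes. [folklore] -/
theorem diagOneXB_apply_zero_one (x : F) (hx : x ≠ 0) :
    (((diagOneXB x hx : borel F) : GL (Fin 2) F) : Matrix (Fin 2) (Fin 2) F) 0 1 = 0 := by
  change ((diagOneX x hx : GL (Fin 2) F) : Matrix (Fin 2) (Fin 2) F) 0 1 = 0
  rw [coe_diagOneX]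
  exact Matrix.diagonal_apply_ne _ (by decide)

omit [NumberField F] in
/-- The diagonal entries of `t_x`. [folklore] -/
theorem diagOneXB_apply_diag (x : F) (hx : x ≠ 0) (j : Fin 2) :
    (((diagOneXB x hx : borel F) : GL (Fin 2) F) : Matrix (Fin 2) (Fin 2) F) j j = ![1, x] j := by
  change ((diagOneX x hx : GL (Fin 2) F) : Matrix (Fin 2) (Fin 2) F) j j = _
  rw [coe_diagOneX, Matrix.diagonal_apply_eq]

omit [NumberField F] in
/-- `det t_x = x` under every embedding. [folklore] -/
theorem det_map_diagOneX {E : Type} [Field E] (τ : F →+* E) (x : F) (hx : x ≠ 0) :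
    ((Matrix.GeneralLinearGroup.det (Matrix.GeneralLinearGroup.map τ (diagOneX x hx)) : Eˣ) : E) = τ x := by
  rw [Matrix.GeneralLinearGroup.val_det_apply]
  change Matrix.det ((((diagOneX x hx : GL (Fin 2) F) : Matrix (Fin 2) (Fin 2) F)).map τ) = τ x
  rw [← RingHom.mapMatrix_apply, ← RingHom.map_det, coe_diagOneX, Matrix.det_diagonal, Fin.prod_univ_two]
  simp

/-- **The algebraic characters at `t_x`**: `χ_I(t_x) = ∏_τ τ(x)^{m + #{i : I τ i = 1}}`. [cite: Harder1987, §2] -/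
theorem ambientChar_diagOneX {E : Type} [Field E] [CharZero E] (d : ℕ) (m : ℤ) (I : AmbIdx E F d) (x : F) (hx : x ≠ 0) :
    ambientChar E F d m I (diagOneX x hx) =
      ∏ τ : F →+* E, τ x ^ (m + ((Finset.univ.filter fun i : Fin d => I τ i = 1).card : ℤ)) := by
  classical
  have hτx : ∀ τ : F →+* E, τ x ≠ 0 := fun τ => (map_ne_zero τ).2 hx
  unfold ambientChar
  rw [← Finset.prod_mul_distrib]
  refine Finset.prod_congr rfl fun τ _ => ?_
  rw [zpow_add₀ (hτx τ), zpow_natCast]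
  congr 1
  · rw [Units.val_zpow_eq_zpow_val, det_map_diagOneX]
  · rw [← Finset.prod_const, ← Finset.prod_filter_mul_prod_filter_not Finset.univ (fun i : Fin d => I τ i = 1)]
    rw [show (∏ i ∈ Finset.univ.filter (fun i : Fin d => ¬ I τ i = 1),
        τ (((diagOneX x hx : GL (Fin 2) F) : Matrix (Fin 2) (Fin 2) F) (I τ i) (I τ i))) = 1 from ?_, mul_one]
    · refine Finset.prod_congr rfl fun i hi => ?_
      rw [(Finset.mem_filter.1 hi).2, coe_diagOneX, Matrix.diagonal_apply_eq]
      rfl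
    · refine Finset.prod_eq_one fun i hi => ?_
      have h1 : I τ i = 0 := by
        have := (Finset.mem_filter.1 hi).2
        omega
      rw [h1, coe_diagOneX, Matrix.diagonal_apply_eq]
      simp

/-- The level `K_f(𝔫) ∩ H_S` of the Borel model. [folklore] -/
abbrev levelH (S : Set (HeightOneSpectrum (𝓞 F))) (𝔫 : Ideal (𝓞 F)) : Subgroup (borelAwayFrom (n := 2) S (K := F)) :=
  ((principalCongruenceLevel 2 F 𝔫).comap (GLn.ofFinite 2 F)).subgroupOf (borelAwayFrom S)

/-! ### The main theorem -/

section Main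

variable (E : Type) [Field E] [CharZero E] [IsAlgClosed E] (wt : Fin 2 → ℤ)

set_option synthInstance.maxHeartbeats 200000 in
/-- **The `t^B_2`-eigenvalues form an algebraic character on the admissible elements.**  See the
module docstring. [cite: Harder1987, §2, (2.3)–(2.7)] -/
theorem exists_torus_exponents (hF : Module.finrank ℚ F = 2) {𝔫 : Ideal (𝓞 F)} (h𝔫 : 𝔫 ≠ 0)
    (hneat : ∀ a : F, (∀ v : HeightOneSpectrum (𝓞 F), v.valuation F a ≤ 1) →
      (∀ v : HeightOneSpectrum (𝓞 F), v.valuation F a⁻¹ ≤ 1) →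
      (∀ v : HeightOneSpectrum (𝓞 F), v.valuation F (a - 1) ≤ idealRadius F v 𝔫) → a = 1)
    {S : Set (HeightOneSpectrum (𝓞 F))} (hS : ∀ v : HeightOneSpectrum (𝓞 F), v.asIdeal ∣ 𝔫 → v ∈ S) (q : ℕ)
    {y₀ : TwistedQuotient.cohomology (borelToAwayFrom F S) (levelH S 𝔫) (borelCoeffRep E wt) q}
    (hy₀ : y₀ ≠ 0) (μ : HeightOneSpectrum (𝓞 F) → E)
    (hμ : ∀ w, w ∉ S → TwistedQuotient.heckeEnd (borelToAwayFrom F S) (levelH S 𝔫)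
      (borelCoeffRep E wt) (borelHeckeElement₂ S w) q y₀ = μ w • y₀) :
    ∃ e : (F →+* E) → ℤ, ∀ (x : 𝓞 F) (hx : x ≠ 0), x - 1 ∈ 𝔫 →
      (∀ w ∈ S, ¬ w.asIdeal ∣ Ideal.span {x}) →
      ((suppOf x hx).toList.map fun w => μ w ^ ordAt w x).prod = ∏ τ : F →+* E, τ (x : F) ^ e τ := by
  classical
  -- a supported boundary point on whose orbit `y₀` is non-zero
  obtain ⟨t, c, hc, hcS, hmem, hz⟩ := exists_toOrbitCohomology_ne_zero_borel h𝔫 hS (borelCoeffRep E wt) q hy₀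
  let L : Subgroup (FiniteAdelicGL 2 F) := (principalCongruenceLevel 2 F 𝔫).comap (GLn.ofFinite 2 F)
  let xH : borelAwayFrom (n := 2) S := ⟨glDiagonal 2 (FiniteAdeleRing (𝓞 F) F) t * c, hmem⟩
  have hxHcoe : (xH : FiniteAdelicGL 2 F) = glDiagonal 2 (FiniteAdeleRing (𝓞 F) F) t * c := rfl
  set z := TwistedQuotient.toOrbitCohomology (borelToAwayFrom F S) (levelH S 𝔫) (borelCoeffRep E wt)
    (xH : borelAwayFrom (n := 2) S ⧸ (levelH S 𝔫)) q y₀ with hzdef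
  -- the admissible elements
  let X : Type := {x : 𝓞 F // x ≠ 0 ∧ x - 1 ∈ 𝔫 ∧ ∀ w ∈ S, ¬ w.asIdeal ∣ Ideal.span {x}}
  have hX0 : ∀ x : X, ((x.1 : 𝓞 F) : F) ≠ 0 := fun x => by exact_mod_cast x.2.1
  let s : X → borel F := fun x => diagOneXB ((x.1 : 𝓞 F) : F) (hX0 x)
  have hsg : ∀ x : X, borelToAwayFrom F S (s x) = admissibleDiagH S ((x.1 : 𝓞 F) : F) (hX0 x) := fun x => rfl
  have hx𝔫 : ∀ x : X, ∀ w : HeightOneSpectrum (𝓞 F), w.asIdeal ∣ 𝔫 → ¬ w.asIdeal ∣ Ideal.span {(x.1 : 𝓞 F)} :=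
    fun x w hw => x.2.2.2 w (hS w hw)
  have hUnr : ∀ w, w ∉ S → ArithmeticQuotient.IsUnramifiedLevel
      (valuedCongruenceSubgroup (Fin 2) (1 : WithZero (Multiplicative ℤ))) (ofLocal 2 F w) (localComponent 2 F w) L :=
    fun w hw => isUnramifiedLevel_comap_principalCongruenceLevel h𝔫 fun h => hw (hS w h)
  -- (μ2) `T_{ι(t_x)} y₀ = M(x) y₀`
  have hT : ∀ x : X, TwistedQuotient.heckeEnd (borelToAwayFrom F S) (levelH S 𝔫) (borelCoeffRep E wt)
      (borelToAwayFrom F S (s x)) q y₀ =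
        ((suppOf x.1 x.2.1).toList.map fun w => μ w ^ ordAt w x.1).prod • y₀ := by
    intro x
    have hsupp : ∀ w ∈ suppOf x.1 x.2.1, w ∉ S := fun w hw hwS => x.2.2.2 w hwS ((mem_suppOf x.2.1).1 hw)
    have h := borelModelHecke_admissibleDiagH S L ((globalEmbedding 2 F).comp (borel F).subtype)
      (borel_globalEmbedding_mem_borelAwayFrom F S) (borelCoeffRep E wt) q h𝔫 le_rfl hS hUnr x.2.1 x.2.2.1 x.2.2.2
    rw [hsg x]
    change borelModelHecke S L ((globalEmbedding 2 F).comp (borel F).subtype)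
      (borel_globalEmbedding_mem_borelAwayFrom F S) (borelCoeffRep E wt) q
      (admissibleDiagH S ((x.1 : 𝓞 F) : F) _) y₀ = _
    rw [h]
    exact list_prod_apply_eq_prod_smul (fun w => borelModelHecke S L ((globalEmbedding 2 F).comp (borel F).subtype)
      (borel_globalEmbedding_mem_borelAwayFrom F S) (borelCoeffRep E wt) q (borelHeckeElement₂ S w) ^ ordAt w x.1)
      (fun w => μ w ^ ordAt w x.1) y₀ _ fun w hw =>
        pow_apply_eq_pow_smul _ _ _ (hμ w (hsupp w (Finset.mem_toList.1 hw))) _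
  -- the hypotheses of `HeckeOrbitConjugation`
  have hg : ∀ x : X, ∀ l ∈ levelH S 𝔫, (borelToAwayFrom F S (s x))⁻¹ * l * borelToAwayFrom F S (s x) ∈ (levelH S 𝔫) := by
    intro x l hl
    have hdec : borelToAwayFrom F S (s x) = torusWord S x.1 x.2.1 * ((torusWord S x.1 x.2.1)⁻¹ *
        admissibleDiagH S ((x.1 : 𝓞 F) : F) (hX0 x)) := by
      rw [mul_inv_cancel_left]; rfl
    have hu := torusWord_inv_mul_admissibleDiagH_mem S h𝔫 (le_refl L) x.2.1 x.2.2.1 (hx𝔫 x)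
    have hsupp : ∀ w ∈ suppOf x.1 x.2.1, w ∉ S := fun w hw hwS => x.2.2.2 w hwS ((mem_suppOf x.2.1).1 hw)
    have hW : ∀ m ∈ levelH S 𝔫, (torusWord S x.1 x.2.1)⁻¹ * m * torusWord S x.1 x.2.1 ∈ (levelH S 𝔫) := by
      refine TwistedQuotient.conj_mem_of_list_prod _ fun g hg' => ?_
      obtain ⟨w, hw, rfl⟩ := List.mem_map.1 hg'
      have hwS : w ∉ S := hsupp w (Finset.mem_toList.1 hw)
      exact TwistedQuotient.conj_mem_of_pow (borelHeckeElement₂_conj_mem hwS (hUnr w hwS)) _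
    rw [hdec, mul_inv_rev, show ((torusWord S x.1 x.2.1)⁻¹ * admissibleDiagH S ((x.1 : 𝓞 F) : F) (hX0 x))⁻¹ *
        (torusWord S x.1 x.2.1)⁻¹ * l * (torusWord S x.1 x.2.1 * ((torusWord S x.1 x.2.1)⁻¹ *
          admissibleDiagH S ((x.1 : 𝓞 F) : F) (hX0 x))) =
        ((torusWord S x.1 x.2.1)⁻¹ * admissibleDiagH S ((x.1 : 𝓞 F) : F) (hX0 x))⁻¹ *
          ((torusWord S x.1 x.2.1)⁻¹ * l * torusWord S x.1 x.2.1) *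
          ((torusWord S x.1 x.2.1)⁻¹ * admissibleDiagH S ((x.1 : 𝓞 F) : F) (hX0 x)) by group]
    exact mul_mem (mul_mem (inv_mem hu) (hW l hl)) hu
  have hx : ∀ x : X, ((xH * borelToAwayFrom F S (s x) : borelAwayFrom (n := 2) S) : borelAwayFrom (n := 2) S ⧸ (levelH S 𝔫)) =
      borelToAwayFrom F S (s x) • ((xH : borelAwayFrom (n := 2) S) : borelAwayFrom (n := 2) S ⧸ (levelH S 𝔫)) := by
    intro x
    rw [MulAction.Quotient.smul_coe, smul_eq_mul, eq_comm, QuotientGroup.eq, Subgroup.mem_subgroupOf,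
      Subgroup.coe_mul, Subgroup.coe_inv, Subgroup.coe_mul, Subgroup.coe_mul, hxHcoe]
    have hgcoe : ((borelToAwayFrom F S (s x) : borelAwayFrom (n := 2) S) : FiniteAdelicGL 2 F) =
        admissibleDiag ((x.1 : 𝓞 F) : F) (hX0 x) := rfl
    rw [hgcoe]
    have h := orbitCondition_admissibleDiag (K := F) h𝔫 (S := {v | v.asIdeal ∣ 𝔫}) (fun _ hv => hv) t hc
      (fun v hv => hcS v hv) x.1 (hX0 x) x.2.2.1
    simpa only [mul_inv_rev, mul_assoc] using h
  -- the torus operators on `H^q(Λ, V_wt)` have the eigenvalues `M(x)` on `z ≠ 0`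
  set Λ := TwistedQuotient.orbitStabilizer (borelToAwayFrom F S) (levelH S 𝔫)
    ((xH : borelAwayFrom (n := 2) S) : borelAwayFrom (n := 2) S ⧸ (levelH S 𝔫)) with hΛdef
  have hΛ : Λ = borelStabilizer 𝔫 t c :=
    TwistedQuotient.orbitStabilizer_codRestrict_eq ((globalEmbedding 2 F).comp (borel F).subtype) L
      (borelAwayFrom (n := 2) S) (borel_globalEmbedding_mem_borelAwayFrom F S) xH
  have hsΛ : ∀ x : X, ∀ γ ∈ Λ, (s x)⁻¹ * γ * s x ∈ Λ := fun x γ hγ =>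
    TwistedQuotient.conj_mem_orbitStabilizer (borelToAwayFrom F S) (levelH S 𝔫) (hg x) xH (hx x) γ hγ
  have heig : ∀ x : X, (groupCohomology.map (subgroupConj Λ (s x) (hsΛ x))
      (resConj Λ (coeffRepB E wt) (s x) (hsΛ x)) q).hom z =
        ((suppOf x.1 x.2.1).toList.map fun w => μ w ^ ordAt w x.1).prod • z := by
    intro x
    have h := TwistedQuotient.toOrbitCohomology_heckeEnd (borelToAwayFrom F S) (levelH S 𝔫) (borelCoeffRep E wt)
      (hg x) xH (hx x) q y₀
    rw [hT x, map_smul] at h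
    exact h.symm
  obtain ⟨I, p, hIp⟩ := exists_torus_eigencharacter_of_eq E wt hneat t hc s
    (fun x => diagOneXB_apply_zero_one _ _) hF h𝔫 q hΛ hsΛ hz _ heig
  -- read off the exponents
  refine ⟨fun τ => lowestEntry wt + ((Finset.univ.filter fun i : Fin (coeffDegree wt) => I τ i = 1).card : ℤ) +
    ((p τ : Fin 2) : ℕ), fun x hx0 hx1 hxS => ?_⟩
  have h := hIp ⟨x, hx0, hx1, hxS⟩
  rw [h]
  have hxF : ((x : 𝓞 F) : F) ≠ 0 := by exact_mod_cast hx0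
  have hratio : diagRatio s ⟨x, hx0, hx1, hxS⟩ = (x : F) := by
    simp only [diagRatio, s]
    rw [diagOneXB_apply_diag, diagOneXB_apply_diag]
    simp
  rw [hratio, show ((s ⟨x, hx0, hx1, hxS⟩ : borel F) : GL (Fin 2) F) = diagOneX (x : F) hxF from rfl,
    ambientChar_diagOneX, ← Finset.prod_mul_distrib]
  refine Finset.prod_congr rfl fun τ _ => ?_
  have hτ : τ (x : F) ≠ 0 := (map_ne_zero τ).2 hxF
  simp only [zpow_add₀ hτ, zpow_natCast]

end Main

end Literature.NumberTheory.Automorphic.ParallelWeight
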